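import Summits.ResolutionOfSingularities.ResolutionOfSingularities.Theorems.FrobeniusClosingPatchingRelPerfectDepthMultiHostFormat
import Summits.ResolutionOfSingularities.ResolutionOfSingularities.Theorems.FrobeniusClosingPatchingRelPerfectMonomialSumStratumStep
import Literature.AlgebraicGeometry.Resolution.SncSaturatedCentre
import HarnessLib

/-!
# Crux `PatchingRelPerfect` (stmt-ResolutionOfSingularities-16161), chain W5.2 — F7(β) d = 2: `MultiHostFormatB`, the CONSTRUCTORS
# (L5) — `consStep` (inCons / cylCons) and `phaseCStep` (poleCons and every Phase C move) as instances of `MultiHostState.step`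

[OURS · L1 W5.2 · F7(β) X-side · res-L1-w52-plan-1 NAMING G11-4 (3) «(L5) `Theorems/…DepthMultiHostConstructors.lean` — inCons / cylCons /
poleCons as INSTANCES of `step` with `hA : host i ≤ 𝓘_W ^ m i` / `hν` discharged from the constructor data (G10-7 (f))»; RULING G10-7
(d) (β-AX) «lift EVERY CJS-B move as inCons (ν := the max legal weight, bookkeeping only) … PHASE C (X-only, local at the poles)»;
CORRECTION 14:41:07Z «PHASE-C RULE: centre := a non-END irreducible COMPONENT of cosupp K».]  Replaces the role of NO printed item;
NOT a statement of the manuscript under review; fact-free.  AI-written; AI review is weaker than expert review.  OURS definitions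
(statement-lane rules: no instances, no notation).

## Contents (namespace `…Theorems.DepthMultiHost.MultiHostState`)
* `consStep S τ W η I ν` — the LIFT constructor (inCons: `W = i(C)` an E-centre; cylCons: `W = W(q)` a regular cylinder closure):
  the hosts CONTAINING `W` are named by `I : Finset (Fin n)` and get order `1`, the others order `0`; `K_consStep` — `K′ = τᶜ(K, ν)`
  under `host i ≤ 𝓘_W (i ∈ I)` and the summand-wise legality `ν ≤ [i ∈ I] + weightAt (exps i) η` (the CJS weight; E-side datum).
* `phaseCOrder S η i := if weightAt (exps i) η = 0 then 1 else 0` and `phaseCStep S τ W η` — the PHASE C constructor (poleCons, the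
  detached-cylinder and cone moves): weight `ν = 1`, centre ANY irreducible closed `W ⊆ cosupp K` snc with the members;
  **`host_le_pow_phaseCOrder`** — BOTH step hypotheses are DISCHARGED from `S.K ≤ 𝓘_W` alone (a summand whose monomial does not pass
  through `η` must have its host through `W`, by irreducibility: `host_le_vanishingIdeal_of_weightAt_eq_zero`); **`K_phaseCStep`** —
  `K′ = τᶜ(K, 1)` under `(hη : IsGenericPoint η W) (hK : S.K ≤ vanishingIdeal W)` only; `K_phaseCStep'` — the same from `W ⊆ cosupp K`.

## References
* J. Kollár, *Lectures on Resolution of Singularities* (2007), (3.111) Steps 1–3. [Kollar2007]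
* E. Bierstone, D. Grigoriev, P. Milman, J. Włodarczyk, *Effective Hironaka resolution and its complexity*, Asian J. Math. 15 (2011),
  Def. 3.1.3 (4), §4 Step 2a. [BierstoneGrigorievMilmanWlodarczyk2011]
-/

-- `Summit.<Summit>.<Sub>.Theorems` with `Sub = Summit` (single-conjunct summit, D-0017)
set_option linter.dupNamespace false

noncomputable section

open CategoryTheory AlgebraicGeometry TopologicalSpace
open Literature.AlgebraicGeometry.Resolution
open Literature.AlgebraicGeometry.Hironaka2017.MonomialPart
open Scheme.IdealSheafData

namespace Summit.ResolutionOfSingularities.ResolutionOfSingularities.Theorems.DepthMultiHost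

universe u

variable {X X' : Scheme.{u}}

/-! ## §0 Irreducibility: a summand through `W` whose monomial misses `η` has its host through `W` -/

/-- A monomial whose members all miss the generic point `η` of `W` is not contained in `𝓘_W`. [folklore] -/
theorem not_monomialIdeal_le_vanishingIdeal_of_weightAt_eq_zero {W : Closeds X} {η : X} (hη : IsGenericPoint η (W : Set X))
    (A : List (X.IdealSheafData × ℕ)) (h : weightAt A η = 0) : ¬ monomialIdeal A ≤ vanishingIdeal W := by
  intro hle
  have hsub : W ≤ (monomialIdeal A).support := le_support_iff_le_vanishingIdeal.mpr hle
  have hηmem : η ∈ ((monomialIdeal A).support : Set X) := hsub hη.mem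
  exact (mem_support_iff_stalkIdeal_ne_top _ _).mp hηmem
    (by rw [stalkIdeal_monomialIdeal, MonomialCleanup.prod_stalkIdeal_pow_eq_top_of_weightAt_eq_zero A η h])

/-- **Irreducibility splits a summand**: if `D · x^A ≤ 𝓘_W` for an irreducible `W` (generic point `η`) and the monomial misses `η`
(`weightAt A η = 0`), then `D ≤ 𝓘_W`. [folklore] -/
theorem host_le_vanishingIdeal_of_weightAt_eq_zero {W : Closeds X} {η : X} (hη : IsGenericPoint η (W : Set X))
    {D : X.IdealSheafData} {A : List (X.IdealSheafData × ℕ)} (hle : D * monomialIdeal A ≤ vanishingIdeal W)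
    (h : weightAt A η = 0) : D ≤ vanishingIdeal W := by
  have hsub : W ≤ (D * monomialIdeal A).support := le_support_iff_le_vanishingIdeal.mpr hle
  have hηmem : η ∈ ((D * monomialIdeal A).support : Set X) := hsub hη.mem
  rw [Scheme.IdealSheafData.support_mul] at hηmem
  rcases hηmem with hD | hA
  · refine le_support_iff_le_vanishingIdeal.mp ?_
    change (W : Set X) ⊆ (D.support : Set X)
    exact (hη.mem_closed_set_iff D.support.isClosed).mp hD
  · exact absurd (le_support_iff_le_vanishingIdeal.mp (show W ≤ (monomialIdeal A).support from
      (hη.mem_closed_set_iff (monomialIdeal A).support.isClosed).mp hA))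
      (not_monomialIdeal_le_vanishingIdeal_of_weightAt_eq_zero hη A h)

namespace MultiHostState

/-! ## §1 The LIFT constructor `consStep` (inCons / cylCons) -/

/-- [OURS · L1 W5.2] **The lift constructor** (inCons: `W = i(C)` for a CJS-B centre `C ⊂ E′`; cylCons: `W` = a regular cylinder
closure): the hosts containing `W` are listed in `I` (order `1`), the others get order `0`; weight `ν` (the CJS weight).
[cite: Kollar2007, (3.111) Steps 1–3] [cite: BierstoneGrigorievMilmanWlodarczyk2011, Def. 3.1.3 (4)] -/
def consStep [IsLocallyNoetherian X] (S : MultiHostState X) (τ : X' ⟶ X) (W : Closeds X) (η : X) (I : Finset (Fin S.n)) (ν : ℕ)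
    (hsnc : HasSNCWith S.𝓔 (vanishingIdeal W)) (hτ : IsBlowup τ (vanishingIdeal W)) : MultiHostState X' :=
  S.step τ W η (fun i => if i ∈ I then 1 else 0) ν hsnc hτ

/-- The order hypothesis of the lift constructor holds: `host i ≤ 𝓘_W ^ [i ∈ I]`. [folklore] -/
theorem host_le_pow_indicator (S : MultiHostState X) (W : Closeds X) (I : Finset (Fin S.n))
    (hI : ∀ i ∈ I, S.host i ≤ vanishingIdeal W) (i : Fin S.n) :
    S.host i ≤ vanishingIdeal W ^ (if i ∈ I then 1 else 0) := by
  by_cases hi : i ∈ I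
  · rw [if_pos hi, pow_one]
    exact hI i hi
  · rw [if_neg hi, pow_zero, Scheme.IdealSheafData.one_eq_top]
    exact le_top

/-- **`K′ = τᶜ(K, ν)` for the lift constructor**, under `host i ≤ 𝓘_W` for the listed hosts and the summand-wise legality
`ν ≤ [i ∈ I] + weightAt (exps i) η`. [cite: Kollar2007, (3.111) Steps 1–3] [cite: BierstoneGrigorievMilmanWlodarczyk2011, §4 Step 2a] -/
theorem K_consStep [IsLocallyNoetherian X] (S : MultiHostState X) (τ : X' ⟶ X) (W : Closeds X) (η : X) (I : Finset (Fin S.n))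
    (ν : ℕ) (hsnc : HasSNCWith S.𝓔 (vanishingIdeal W)) (hτ : IsBlowup τ (vanishingIdeal W)) (hη : IsGenericPoint η (W : Set X))
    (hI : ∀ i ∈ I, S.host i ≤ vanishingIdeal W) (hν : ∀ i, ν ≤ (if i ∈ I then 1 else 0) + weightAt (S.exps i) η) :
    (S.consStep τ W η I ν hsnc hτ).K = controlledTransform τ (vanishingIdeal W) S.K ν :=
  S.K_step τ W η _ ν hsnc hτ hη (S.host_le_pow_indicator W I hI) hν

/-- `τ^* K ≤ F^ν` for the lift constructor (legality on `X′`). [cite: Kollar2007, (3.111) Step 1] -/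
theorem comap_K_le_pow_consStep [IsLocallyNoetherian X] (S : MultiHostState X) (τ : X' ⟶ X) (W : Closeds X) (η : X)
    (I : Finset (Fin S.n)) (ν : ℕ) (hsnc : HasSNCWith S.𝓔 (vanishingIdeal W)) (hτ : IsBlowup τ (vanishingIdeal W))
    (hη : IsGenericPoint η (W : Set X)) (hI : ∀ i ∈ I, S.host i ≤ vanishingIdeal W)
    (hν : ∀ i, ν ≤ (if i ∈ I then 1 else 0) + weightAt (S.exps i) η) :
    S.K.comap τ ≤ (vanishingIdeal W).comap τ ^ ν :=
  S.comap_K_le_pow τ W η _ ν hsnc hτ hη (S.host_le_pow_indicator W I hI) hν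

/-! ## §2 The PHASE C constructor `phaseCStep` (poleCons; detached cylinders; cones): weight one, orders discharged -/

/-- [OURS · L1 W5.2] **Phase C host orders**: order `1` for a summand whose monomial misses the generic point `η` of the centre
(its host must then pass through `W`), order `0` otherwise. [cite: BierstoneGrigorievMilmanWlodarczyk2011, Def. 3.1.3 (4)] -/
def phaseCOrder (S : MultiHostState X) (η : X) (i : Fin S.n) : ℕ :=
  if weightAt (S.exps i) η = 0 then 1 else 0

/-- **The order hypothesis is discharged by legality**: `K ≤ 𝓘_W` (i.e. `W ⊆ cosupp K`) gives `host i ≤ 𝓘_W ^ phaseCOrder S η i` for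
every summand, `W` irreducible with generic point `η`. [folklore] -/
theorem host_le_pow_phaseCOrder (S : MultiHostState X) {W : Closeds X} {η : X} (hη : IsGenericPoint η (W : Set X))
    (hK : S.K ≤ vanishingIdeal W) (i : Fin S.n) : S.host i ≤ vanishingIdeal W ^ S.phaseCOrder η i := by
  unfold phaseCOrder
  by_cases h : weightAt (S.exps i) η = 0
  · rw [if_pos h, pow_one]
    exact host_le_vanishingIdeal_of_weightAt_eq_zero hη ((S.summand_le_K i).trans hK) h
  · rw [if_neg h, pow_zero, Scheme.IdealSheafData.one_eq_top]
    exact le_top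

/-- **The weight hypothesis is discharged**: `1 ≤ phaseCOrder S η i + weightAt (exps i) η` for every summand. [folklore] -/
theorem one_le_phaseCOrder_add_weightAt (S : MultiHostState X) (η : X) (i : Fin S.n) :
    1 ≤ S.phaseCOrder η i + weightAt (S.exps i) η := by
  unfold phaseCOrder
  by_cases h : weightAt (S.exps i) η = 0
  · rw [if_pos h, h]
  · rw [if_neg h, zero_add]
    exact Nat.one_le_iff_ne_zero.mpr h

/-- [OURS · L1 W5.2] **The Phase C constructor** (poleCons = the blow-up of a pole; the detached-cylinder and cone-surface moves):
weight `1`, centre any irreducible closed `W` snc with the members, orders `phaseCOrder`. E-invisible when `W` misses `E′`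
(`E′` then contributes nothing to the new exponent: `weightAt` is read at `η ∉ E′`). [cite: Kollar2007, (3.111) Steps 1–3] -/
def phaseCStep [IsLocallyNoetherian X] (S : MultiHostState X) (τ : X' ⟶ X) (W : Closeds X) (η : X)
    (hsnc : HasSNCWith S.𝓔 (vanishingIdeal W)) (hτ : IsBlowup τ (vanishingIdeal W)) : MultiHostState X' :=
  S.step τ W η (S.phaseCOrder η) 1 hsnc hτ

/-- **`K′ = τᶜ(K, 1)` for the Phase C constructor, from legality `K ≤ 𝓘_W` ALONE** (rule «centre := an irreducible component of
`cosupp K`»). [cite: Kollar2007, (3.111) Steps 1–3] [cite: BierstoneGrigorievMilmanWlodarczyk2011, §4 Step 2a] -/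
theorem K_phaseCStep [IsLocallyNoetherian X] (S : MultiHostState X) (τ : X' ⟶ X) (W : Closeds X) (η : X)
    (hsnc : HasSNCWith S.𝓔 (vanishingIdeal W)) (hτ : IsBlowup τ (vanishingIdeal W)) (hη : IsGenericPoint η (W : Set X))
    (hK : S.K ≤ vanishingIdeal W) :
    (S.phaseCStep τ W η hsnc hτ).K = controlledTransform τ (vanishingIdeal W) S.K 1 :=
  S.K_step τ W η _ 1 hsnc hτ hη (S.host_le_pow_phaseCOrder hη hK) (S.one_le_phaseCOrder_add_weightAt η)

/-- The same from the set-theoretic legality `W ⊆ cosupp K`. [folklore] -/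
theorem K_phaseCStep' [IsLocallyNoetherian X] (S : MultiHostState X) (τ : X' ⟶ X) (W : Closeds X) (η : X)
    (hsnc : HasSNCWith S.𝓔 (vanishingIdeal W)) (hτ : IsBlowup τ (vanishingIdeal W)) (hη : IsGenericPoint η (W : Set X))
    (hW : (W : Set X) ⊆ (S.K.support : Set X)) :
    (S.phaseCStep τ W η hsnc hτ).K = controlledTransform τ (vanishingIdeal W) S.K 1 :=
  S.K_phaseCStep τ W η hsnc hτ hη (le_support_iff_le_vanishingIdeal.mp hW)

/-- `τ^* K ≤ F` for the Phase C constructor: the weight-one blow-up of a component of the cosupport is legal on `X′`.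
[cite: Kollar2007, (3.111) Step 1] -/
theorem comap_K_le_phaseCStep [IsLocallyNoetherian X] (S : MultiHostState X) (τ : X' ⟶ X) (W : Closeds X) (η : X)
    (hsnc : HasSNCWith S.𝓔 (vanishingIdeal W)) (hτ : IsBlowup τ (vanishingIdeal W)) (hη : IsGenericPoint η (W : Set X))
    (hK : S.K ≤ vanishingIdeal W) : S.K.comap τ ≤ (vanishingIdeal W).comap τ := by
  have h := S.comap_K_le_pow τ W η _ 1 hsnc hτ hη (S.host_le_pow_phaseCOrder hη hK) (S.one_le_phaseCOrder_add_weightAt η)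
  rwa [pow_one] at h

/-- **Total-transform form** `τ^* K = F · K′` for the Phase C constructor. [cite: BierstoneGrigorievMilmanWlodarczyk2011, Lemma 3.2.1] -/
theorem comap_K_eq_mul_K_phaseCStep [IsLocallyNoetherian X] (S : MultiHostState X) (τ : X' ⟶ X) (W : Closeds X) (η : X)
    (hsnc : HasSNCWith S.𝓔 (vanishingIdeal W)) (hτ : IsBlowup τ (vanishingIdeal W)) (hη : IsGenericPoint η (W : Set X))
    (hK : S.K ≤ vanishingIdeal W) :
    S.K.comap τ = (vanishingIdeal W).comap τ * (S.phaseCStep τ W η hsnc hτ).K := by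
  have h := S.comap_K_eq_pow_mul_K_step τ W η _ 1 hsnc hτ hη (S.host_le_pow_phaseCOrder hη hK)
    (S.one_le_phaseCOrder_add_weightAt η)
  rwa [pow_one] at h

end MultiHostState

end Summit.ResolutionOfSingularities.ResolutionOfSingularities.Theorems.DepthMultiHost

end
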